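import Mathlib
import HarnessLib
import Literature.Analysis.FluidPDE.AxisymmetricTypeIAxis
import Literature.Analysis.FluidPDE.AxisymmetricL3Gauge
import Literature.Analysis.FluidPDE.AxisymmetricL3PressureBounds
import Literature.Analysis.FluidPDE.KNSSNoAxisymmetricTypeIHolds
import Summits.NavierStokesRegularity.NavierStokesRegularity.Theorems.LocalVelCompTubeDoorAxisymOffAxis

/-!
# The door family in the AXISYMMETRIC regime (swirl allowed): an ON-AXIS locally Type-I point is backward bounded
# (Seregin–Šverák 2009 Thm 1.1, transported to the doors' vocabulary), hence EVERY locally Type-I point is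

Cell ns-regularity-ideate, seat p6 (route-directed support for the door family of LADDER-NS N0; completes the
axisymmetric S-cases: `…LocalHelicityTubeDoorAxisymNoSwirlCase` (no swirl, any point, the doors' own zoom mechanism),
`…LocalVelCompTubeDoorAxisymOffAxis` (swirl allowed, off the axis, diagonal zoom), and this file (swirl allowed, on the
axis)).  The on-axis case WITH swirl is exactly Seregin–Šverák 2009 Thm 1.1, a DISCHARGED barrier of the tree
(`Literature.Barriers.NavierStokesRegularity.AxisymmetricTypeIExclusion`, `axisymmetricTypeIExclusion_of_tree`), stated
in the Seregin–Šverák vocabulary (distributional solution on the unit cylinder `𝒞 × ]−1,0[`, `L³`/`L^{3/2}` classes,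
a.e. Type-I bound).  The tree's bridge `axisymmetric_typeI_boundedNearTop_axis_of_barrier`
(`Literature/Analysis/FluidPDE/AxisymmetricTypeIAxis.lean`) transports it to classical Leray–Hopf solutions with a GLOBAL
Type-I rate (`AxisymmetricTypeIHyp`); here the SAME proof is run with the doors' LOCAL Type-I hypothesis at `(x₀, T)` —
the only place the rate enters is on the rescaled unit cylinder, i.e. inside one backward parabolic cylinder about
`(T, x₀)` — over the weaker standing hypotheses `AxisymmetricL3Hyp` (classical, Leray–Hopf, bounded on sub-slabs,
axisymmetric), whose gauge / `L³` / `L^{3/2}` lemmas are tree theorems (`AxisymmetricL3Gauge`, `AxisymmetricL3PressureBounds`):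

* `isBackwardBoundedAt_of_localTypeI_axisymmetric_onAxis` — **classical Leray–Hopf solution, bounded on every sub-slab
  `[0,T'] × ℝ³` (`T' < T`, i.e. `T` is the first possible blow-up time), axisymmetric at every time, locally Type I at
  `(x₀, T)` with `x₀` ON the axis ⇒ backward bounded at `(x₀, T)`** (proof adapted from
  `axisymmetric_typeI_boundedNearTop_axis_of_barrier`, Seregin–Šverák's argument: gauged pressure, viscosity-normalising
  parabolic rescaling about `(T, x₀)`, the classes by change of variables, axisymmetry of the rescaled field, the LOCAL
  rate in rescaled time, the barrier, transport of the essential bound back to the continuous `u`);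
* `isBackwardBoundedAt_of_localTypeI_axisymmetric` — **hence at EVERY point** (off the axis:
  `…AxisymOffAxis.isBackwardBoundedAt_of_localTypeI_axisymmetric_offAxis`, which needs the rapidly decaying datum of
  the zoom frame).

WHAT THIS IS NOT: not a claim about Navier–Stokes regularity (Clay A) — the axisymmetric S-restricted case of the door
family, INSIDE the printed regime (KNSS 2009 / Seregin–Šverák 2009); new only as a door-vocabulary kernel statement
(bears_on LADDER-NS N0).
-/

noncomputable section

-- the summit and its single sub-problem share the name (CONVENTIONS §1), as in every Theorems file
set_option linter.dupNamespace false

namespace Summit.NavierStokesRegularity.NavierStokesRegularity.Theorems.LocalVelCompTubeDoorAxisymOnAxis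

open MeasureTheory Set Function Filter Topology TopologicalSpace Metric
open scoped NNReal ENNReal
open Literature.Analysis Literature.Analysis.FluidPDE
open Literature.Barriers.NavierStokesRegularity
open Summit.NavierStokesRegularity.NavierStokesRegularity.Theorems.LocalVelCompTubeDoorAxisymOffAxis

/-- **Local Type I at an ON-AXIS point of an axisymmetric flow (swirl allowed) ⇒ backward bounded** (Seregin–Šverák
2009 Thm 1.1 in the doors' vocabulary; the solution is assumed bounded on every sub-slab `[0,T'] × ℝ³`, `T' < T`).
-- adapted from Literature/Analysis/FluidPDE/AxisymmetricTypeIAxis.lean (`axisymmetric_typeI_boundedNearTop_axis_of_barrier`),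
-- with the global Type-I rate replaced by the local one. -/
theorem isBackwardBoundedAt_of_localTypeI_axisymmetric_onAxis
    (ν T : ℝ) (hν : 0 < ν) (hT : 0 < T) (u : ℝ → EuclideanSpace ℝ (Fin 3) → EuclideanSpace ℝ (Fin 3))
    (p : ℝ → EuclideanSpace ℝ (Fin 3) → ℝ)
    (hcl : IsClassicalNSSolutionOn (Set.Ico 0 T) ν 0 u p) (hLH : IsLerayHopfOn T ν 0 (u 0) u)
    (hbdd : ∀ T' < T, ∃ M : ℝ, ∀ t ∈ Set.Icc 0 T', ∀ x, ‖u t x‖ ≤ M)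
    (haxisym : ∀ t ∈ Set.Ico 0 T, IsAxisymmetric (u t))
    (x₀ : EuclideanSpace ℝ (Fin 3)) (hx₀ : cylRadius x₀ = 0) (ρ₀ M₀ : ℝ) (hρ₀ : 0 < ρ₀)
    (hM₀ : ∀ t ∈ Set.Ico 0 T, T - ρ₀ ^ 2 < t → ∀ x ∈ Metric.ball x₀ ρ₀, ‖u t x‖ * Real.sqrt (ν * (T - t)) ≤ M₀) :
    IsBackwardBoundedAt u T x₀ := by
  have H : AxisymmetricL3Hyp ν T u p := ⟨hν, hT, hcl, hLH, hbdd, haxisym⟩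
  -- scales: `R > 0` with `ρ = R (2 + 1/√ν) ≤ min (√T / 2) (ρ₀ / 2)`
  set κ : ℝ := 2 + (Real.sqrt ν)⁻¹ with hκ
  have hκpos : 0 < κ := by positivity
  set ρ : ℝ := min (Real.sqrt T / 2) (ρ₀ / 2) with hρdef
  have hρpos : 0 < ρ := lt_min (by positivity) (by positivity)
  have hρρ₀ : ρ < ρ₀ := (min_le_right _ _).trans_lt (by linarith)
  set R : ℝ := ρ / κ with hR
  have hRpos : 0 < R := by positivity
  have hρ : ρ = R * κ := by rw [hR]; field_simp
  have hρT : ρ ^ 2 ≤ T := by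
    have h1 : ρ ≤ Real.sqrt T / 2 := min_le_left _ _
    have h2 : ρ ^ 2 ≤ (Real.sqrt T / 2) ^ 2 := pow_le_pow_left₀ hρpos.le h1 2
    rw [div_pow, Real.sq_sqrt hT.le] at h2; linarith
  set α : ℝ := R / ν with hα
  set β : ℝ := R ^ 2 / ν with hβdef
  have hαpos : 0 < α := by positivity
  have hβpos : 0 < β := by positivity
  have hβeq : β = α * R := by rw [hβdef, hα]; field_simp
  have hβρ : β ≤ ρ ^ 2 := by
    have h1 : β = (R * (Real.sqrt ν)⁻¹) ^ 2 := by
      rw [hβdef, mul_pow, inv_pow, Real.sq_sqrt hν.le, div_eq_mul_inv]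
    rw [h1, hρ]
    have h2 : (Real.sqrt ν)⁻¹ ≤ κ := by rw [hκ]; linarith
    exact pow_le_pow_left₀ (by positivity) (mul_le_mul_of_nonneg_left h2 hRpos.le) 2
  have h2Rρ : 2 * R ≤ ρ := by
    rw [hρ, hκ]
    have : 0 ≤ (Real.sqrt ν)⁻¹ := by positivity
    nlinarith
  -- the gauged pressure and the physical cylinder
  obtain ⟨q, hsuit, hqae, -⟩ := H.exists_gauged_pressure
  have hPopen := isOpen_image_stAffine_ssCylinder (T := T) (x₀ := x₀) hβpos.ne' hRpos.ne'
  set PO : Opens (ℝ × EuclideanSpace ℝ (Fin 3)) := ⟨stAffine β R T x₀ '' ssCylinder, hPopen⟩ with hPO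
  have hPcyl : (PO : Set (ℝ × EuclideanSpace ℝ (Fin 3))) ⊆ parabolicCylinder ρ ((T : ℝ), x₀) :=
    image_stAffine_ssCylinder_subset hβpos hRpos hβρ h2Rρ
  have hcylslab : parabolicCylinder ρ ((T : ℝ), x₀) ⊆ Ioo 0 T ×ˢ (univ : Set (EuclideanSpace ℝ (Fin 3))) := by
    intro z hz
    rw [mem_parabolicCylinder] at hz
    exact ⟨⟨by nlinarith [hz.1.1], hz.1.2⟩, mem_univ _⟩
  have hPslab : (PO : Set (ℝ × EuclideanSpace ℝ (Fin 3))) ⊆ Ioo 0 T ×ˢ (univ : Set (EuclideanSpace ℝ (Fin 3))) :=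
    hPcyl.trans hcylslab
  -- the rescaled pair solves the unit-viscosity system in distributions on the unit cylinder
  have hdist : IsDistributionalNSSolutionOn ssCylinderOpens 1 0 (α • stPull β R T x₀ u)
      (α ^ 2 • stPull β R T x₀ q) := by
    have h0 := ((hsuit PO hPslab).distributional).stRescale hαpos hRpos hβeq T x₀
    have hvisc : α * ν / R = 1 := by
      rw [hα, div_mul_cancel₀ R hν.ne', div_self hRpos.ne']
    have hforce : ((α ^ 2 * R) • stPull β R T x₀ (0 : ℝ → EuclideanSpace ℝ (Fin 3) → EuclideanSpace ℝ (Fin 3))) = 0 := by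
      funext s y; simp [stPull]
    rw [hvisc, hforce, stPreimage_image_ssCylinder hβpos.ne' hRpos.ne' hPopen] at h0
    exact h0
  -- `v ∈ L³(Q)`
  have hpre : stAffine β R T x₀ ⁻¹' (PO : Set (ℝ × EuclideanSpace ℝ (Fin 3))) = ssCylinder :=
    preimage_image_eq _ (injective_stAffine hβpos.ne' hRpos.ne' T x₀)
  have hL3 : ∫⁻ z in ssCylinder, ‖(α • stPull β R T x₀ u) z.1 z.2‖ₑ ^ (3 : ℕ) < ∞ := by
    rw [← hpre, setLIntegral_enorm_pow_stRescale hβpos hRpos T x₀ α u _ 3]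
    refine ENNReal.mul_lt_top (ENNReal.mul_lt_top (ENNReal.pow_lt_top enorm_lt_top) ENNReal.ofReal_lt_top) ?_
    exact lt_of_le_of_lt (lintegral_mono_set hPcyl) (H.lintegral_cylinder_enorm_pow_three_lt_top hρT x₀)
  -- `π ∈ L^{3/2}(Q)`
  have hL32 : ∫⁻ z in ssCylinder, ‖(α ^ 2 • stPull β R T x₀ q) z.1 z.2‖ₑ ^ (3 / 2 : ℝ) < ∞ := by
    rw [← hpre, setLIntegral_enorm_rpow_stRescale hβpos hRpos T x₀ (α ^ 2) q _ (by norm_num)]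
    refine ENNReal.mul_lt_top (ENNReal.mul_lt_top
      (ENNReal.rpow_lt_top_of_nonneg (by norm_num) enorm_ne_top) ENNReal.ofReal_lt_top) ?_
    exact lt_of_le_of_lt (lintegral_mono_set hPcyl)
      (H.lintegral_cylinder_gauged_pressure_lt_top hqae hρT x₀)
  -- axisymmetry of the rescaled slices (`x₀` is fixed by the rotations, which are linear)
  have haxi : ∀ s ∈ Ioo (-1 : ℝ) 0, IsAxisymmetric ((α • stPull β R T x₀ u) s) := by
    intro s hs θ y
    have hτ : T + β * s ∈ Ico 0 T := by
      constructor
      · have : β ≤ T := hβρ.trans hρT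
        nlinarith [hs.1]
      · nlinarith [hs.2]
    simp only [smul_stPull_apply]
    rw [show x₀ + R • rotZ θ y = rotZ θ (x₀ + R • y) by
      rw [SereginSverak2009.rotZ_add_vec, SereginSverak2009.rotZ_smul_vec,
        rotZ_eq_self_of_cylRadius_eq_zero θ hx₀],
      H.axisymmetric _ hτ θ, SereginSverak2009.rotZ_smul_vec]
  -- the LOCAL Type I rate in the rescaled time: the physical points lie in `Q_ρ(T, x₀) ⊆ (T − ρ₀², T) × B(x₀, ρ₀)`
  have htypeI : ∃ C' : ℝ, ∀ᵐ z ∂(volume.restrict ssCylinder),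
      Real.sqrt (-z.1) * ‖(α • stPull β R T x₀ u) z.1 z.2‖ ≤ C' := by
    refine ⟨α / Real.sqrt β * (max M₀ 0 / Real.sqrt ν), (ae_restrict_mem isOpen_ssCylinder.measurableSet).mono ?_⟩
    intro z hz
    obtain ⟨hs, -, -⟩ := mem_ssCylinder.1 hz
    have hτ : T + β * z.1 ∈ Ico 0 T := by
      constructor
      · have : β ≤ T := hβρ.trans hρT
        nlinarith [hs.1]
      · nlinarith [hs.2]
    -- the physical point lies in the parabolic cylinder `Q_ρ(T, x₀)`
    have hphys : ((T + β * z.1, x₀ + R • z.2) : ℝ × EuclideanSpace ℝ (Fin 3)) ∈ parabolicCylinder ρ ((T : ℝ), x₀) := by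
      have hmem : stAffine β R T x₀ z ∈ (PO : Set (ℝ × EuclideanSpace ℝ (Fin 3))) := mem_image_of_mem _ hz
      have := hPcyl hmem
      rwa [stAffine_apply] at this
    rw [mem_parabolicCylinder] at hphys
    have htρ₀ : T - ρ₀ ^ 2 < T + β * z.1 := by
      have h1 : T - ρ ^ 2 < T + β * z.1 := by
        have := hphys.1.1; simp only at this; linarith
      have h2 : ρ ^ 2 < ρ₀ ^ 2 := by nlinarith [hρρ₀, hρpos]
      linarith
    have hxρ₀ : x₀ + R • z.2 ∈ ball x₀ ρ₀ := by
      have := hphys.2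
      simp only at this
      rw [mem_ball]
      exact this.trans hρρ₀
    -- the local rate, normalised: `√(T − t) ‖u t x‖ ≤ max M₀ 0 / √ν`
    have hrate0 := hM₀ _ hτ htρ₀ _ hxρ₀
    have hsν : 0 < Real.sqrt ν := Real.sqrt_pos.2 hν
    have hrate : Real.sqrt (T - (T + β * z.1)) * ‖u (T + β * z.1) (x₀ + R • z.2)‖ ≤ max M₀ 0 / Real.sqrt ν := by
      rw [le_div_iff₀ hsν]
      have e : Real.sqrt (ν * (T - (T + β * z.1))) = Real.sqrt ν * Real.sqrt (T - (T + β * z.1)) :=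
        Real.sqrt_mul hν.le _
      calc Real.sqrt (T - (T + β * z.1)) * ‖u (T + β * z.1) (x₀ + R • z.2)‖ * Real.sqrt ν
          = ‖u (T + β * z.1) (x₀ + R • z.2)‖ * Real.sqrt (ν * (T - (T + β * z.1))) := by rw [e]; ring
        _ ≤ M₀ := hrate0
        _ ≤ max M₀ 0 := le_max_left _ _
    have hsq : Real.sqrt (T - (T + β * z.1)) = Real.sqrt β * Real.sqrt (-z.1) := by
      rw [show T - (T + β * z.1) = β * (-z.1) by ring, Real.sqrt_mul hβpos.le]
    rw [hsq] at hrate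
    have hsβ : 0 < Real.sqrt β := Real.sqrt_pos.2 hβpos
    rw [smul_stPull_apply, norm_smul, Real.norm_of_nonneg hαpos.le]
    calc Real.sqrt (-z.1) * (α * ‖u (T + β * z.1) (x₀ + R • z.2)‖)
        = α / Real.sqrt β * (Real.sqrt β * Real.sqrt (-z.1) * ‖u (T + β * z.1) (x₀ + R • z.2)‖) := by
          field_simp
      _ ≤ α / Real.sqrt β * (max M₀ 0 / Real.sqrt ν) :=
          mul_le_mul_of_nonneg_left hrate (by positivity)
  -- the barrier (Seregin–Šverák 2009 Thm 3.1, DISCHARGED in the tree): essential boundedness near the vertex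
  obtain ⟨r, hr, hbd⟩ := axisymmetricTypeIExclusion_of_tree _ _ hdist hL3 hL32 haxi htypeI
  -- an a.e. bound for `u ∘ Φ` on `Q_r(0)`
  set S' : Set (ℝ × EuclideanSpace ℝ (Fin 3)) := parabolicCylinder r ((0 : ℝ), (0 : EuclideanSpace ℝ (Fin 3))) with hS'
  set M : ℝ := (eLpNorm (uncurry (α • stPull β R T x₀ u)) ∞ (volume.restrict S')).toReal with hM
  have haeS' : ∀ᵐ w ∂(volume.restrict S'), ‖u (stAffine β R T x₀ w).1 (stAffine β R T x₀ w).2‖ ≤ M / α := by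
    have h1 := ae_le_eLpNormEssSup (μ := volume.restrict S') (f := uncurry (α • stPull β R T x₀ u))
    filter_upwards [h1] with w hw
    rw [← eLpNorm_exponent_top] at hw
    have hw' : ‖uncurry (α • stPull β R T x₀ u) w‖ ≤ M := by
      rw [hM, ← ENNReal.ofReal_le_iff_le_toReal hbd.ne, ofReal_norm]
      exact hw
    rw [le_div_iff₀' hαpos]
    have e : uncurry (α • stPull β R T x₀ u) w =
        α • u (stAffine β R T x₀ w).1 (stAffine β R T x₀ w).2 := by
      obtain ⟨s, y⟩ := w; rfl
    rw [e, norm_smul, Real.norm_of_nonneg hαpos.le] at hw'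
    exact hw'
  -- transported to the image `Φ(Q_r(0))`
  have haeP : ∀ᵐ z ∂((volume : Measure (ℝ × EuclideanSpace ℝ (Fin 3))).restrict (stAffine β R T x₀ '' S')),
      ‖u z.1 z.2‖ ≤ M / α := by
    refine ae_restrict_of_ae_restrict_preimage_stAffine hβpos hRpos T x₀
      (P := fun z : ℝ × EuclideanSpace ℝ (Fin 3) => ‖u z.1 z.2‖ ≤ M / α) ?_
    rw [preimage_image_eq _ (injective_stAffine hβpos.ne' hRpos.ne' T x₀)]
    exact haeS'
  -- a backward neighbourhood of `(T, x₀)` inside `Φ(Q_r(0))` and inside the slab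
  set r' : ℝ := min (r * min (Real.sqrt β) R) (Real.sqrt T / 2) with hr'
  have hmin : 0 < min (Real.sqrt β) R := lt_min (Real.sqrt_pos.2 hβpos) hRpos
  have hr'pos : 0 < r' := lt_min (mul_pos hr hmin) (by positivity)
  have hr'le : r' ≤ r * min (Real.sqrt β) R := min_le_left _ _
  have hr'T : r' ^ 2 ≤ T / 4 := by
    have h1 : r' ≤ Real.sqrt T / 2 := min_le_right _ _
    have h2 : r' ^ 2 ≤ (Real.sqrt T / 2) ^ 2 := pow_le_pow_left₀ hr'pos.le h1 2
    rw [div_pow, Real.sq_sqrt hT.le] at h2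
    linarith
  set U : Set (ℝ × EuclideanSpace ℝ (Fin 3)) := Ioo (T - r' ^ 2) T ×ˢ ball x₀ r' with hU
  have hUsub : U ⊆ stAffine β R T x₀ '' S' := by
    rintro ⟨t, x⟩ ⟨ht, hx⟩
    refine ⟨((t - T) / β, R⁻¹ • (x - x₀)), ?_, ?_⟩
    · rw [hS', mem_parabolicCylinder]
      have hr'β : r' ^ 2 ≤ β * r ^ 2 := by
        have h1 : r' ≤ r * Real.sqrt β :=
          hr'le.trans (mul_le_mul_of_nonneg_left (min_le_left _ _) hr.le)
        have h2 : r' ^ 2 ≤ (r * Real.sqrt β) ^ 2 := pow_le_pow_left₀ hr'pos.le h1 2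
        rw [mul_pow, Real.sq_sqrt hβpos.le] at h2
        linarith
      have hr'R : r' ≤ R * r := by
        have h1 : r' ≤ r * R := hr'le.trans (mul_le_mul_of_nonneg_left (min_le_right _ _) hr.le)
        linarith
      refine ⟨⟨?_, ?_⟩, ?_⟩
      · show (0 : ℝ) - r ^ 2 < (t - T) / β
        rw [lt_div_iff₀ hβpos]; nlinarith [ht.1]
      · show (t - T) / β < 0
        exact div_neg_of_neg_of_pos (by linarith [ht.2]) hβpos
      · show dist (R⁻¹ • (x - x₀)) 0 < r
        rw [dist_zero_right, norm_smul, Real.norm_of_nonneg (inv_nonneg.2 hRpos.le),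
          inv_mul_lt_iff₀ hRpos]
        rw [mem_ball, dist_eq_norm] at hx
        linarith
    · rw [stAffine_apply]
      ext1
      · show T + β * ((t - T) / β) = t
        field_simp; ring
      · show x₀ + R • R⁻¹ • (x - x₀) = x
        rw [smul_smul, mul_inv_cancel₀ hRpos.ne', one_smul, add_sub_cancel]
  -- everywhere bound on `U` by continuity
  have hUopen : IsOpen U := isOpen_Ioo.prod isOpen_ball
  have hUslab : U ⊆ Ioo 0 T ×ˢ (univ : Set (EuclideanSpace ℝ (Fin 3))) := by
    rintro ⟨t, x⟩ ⟨ht, -⟩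
    exact ⟨⟨by nlinarith [ht.1], ht.2⟩, mem_univ _⟩
  have hcont : ContinuousOn (fun z : ℝ × EuclideanSpace ℝ (Fin 3) => u z.1 z.2) U :=
    H.classical_Ioo.smooth_velocity.continuousOn.mono hUslab
  have hbound := SereginSverak2009.forall_le_of_ae_le_of_continuousOn hUopen hcont.norm
    continuousOn_const (ae_restrict_of_ae_restrict_of_subset hUsub haeP)
  exact ⟨r', hr'pos, M / α, fun t ht x hx => hbound (t, x) ⟨ht, hx⟩⟩

/-- **Axisymmetric (swirl allowed) + local Type I at ANY point ⇒ backward bounded there** (on the axis: the theorem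
above; off the axis: `…AxisymOffAxis.isBackwardBoundedAt_of_localTypeI_axisymmetric_offAxis`, by the doors' diagonal
zoom, which needs the rapidly decaying datum). -/
theorem isBackwardBoundedAt_of_localTypeI_axisymmetric
    (ν T : ℝ) (hν : 0 < ν) (hT : 0 < T) (u : ℝ → EuclideanSpace ℝ (Fin 3) → EuclideanSpace ℝ (Fin 3))
    (p : ℝ → EuclideanSpace ℝ (Fin 3) → ℝ)
    (hcl : IsClassicalNSSolutionOn (Set.Ico 0 T) ν 0 u p) (hLH : IsLerayHopfOn T ν 0 (u 0) u)
    (hdec : HasRapidSpatialDecay (u 0))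
    (hbdd : ∀ T' < T, ∃ M : ℝ, ∀ t ∈ Set.Icc 0 T', ∀ x, ‖u t x‖ ≤ M)
    (haxisym : ∀ t, IsAxisymmetric (u t))
    (x₀ : EuclideanSpace ℝ (Fin 3)) (ρ₀ M₀ : ℝ) (hρ₀ : 0 < ρ₀)
    (hM₀ : ∀ t ∈ Set.Ico 0 T, T - ρ₀ ^ 2 < t → ∀ x ∈ Metric.ball x₀ ρ₀, ‖u t x‖ * Real.sqrt (ν * (T - t)) ≤ M₀) :
    IsBackwardBoundedAt u T x₀ := by
  by_cases hx₀ : rotGen x₀ = 0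
  · have hcyl : cylRadius x₀ = 0 := by
      have h0 : x₀ 0 = 0 := by simpa using congrArg (fun w : EuclideanSpace ℝ (Fin 3) => w 1) hx₀
      have h1 : x₀ 1 = 0 := by
        have := congrArg (fun w : EuclideanSpace ℝ (Fin 3) => w 0) hx₀
        simpa using this
      rw [cylRadius_eq_zero_iff]
      exact ⟨h0, h1⟩
    exact isBackwardBoundedAt_of_localTypeI_axisymmetric_onAxis ν T hν hT u p hcl hLH hbdd (fun t _ => haxisym t)
      x₀ hcyl ρ₀ M₀ hρ₀ hM₀
  · exact isBackwardBoundedAt_of_localTypeI_axisymmetric_offAxis ν T hν hT u p hcl hLH hdec haxisym x₀ hx₀ ρ₀ M₀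
      hρ₀ hM₀

end Summit.NavierStokesRegularity.NavierStokesRegularity.Theorems.LocalVelCompTubeDoorAxisymOnAxis

end
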